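import Summits.Ventures.LatticeQCDFlow.Exactness.FlowSamplerGroupSymmetrisation
import Summits.Ventures.LatticeQCDFlow.Exactness.FlowSamplerSymmetrisationDirichlet
import HarnessLib

/-!
# A MIXTURE OF FLOWS IS NEVER WORSE THAN THE HARMONIC MEAN OF ITS COMPONENTS: `τ_int^{Σ αᵢ q̃ᵢ}(g) + ½ ≤ (Σᵢ αᵢ/(τ_int^{q̃ᵢ}(g) + ½))⁻¹` for every square-integrable observable

HONEST FRAMING: exact (Metropolis-corrected) sampling algorithms for lattice gauge theory;
figures of merit are autocorrelation/cost numbers at stated couplings and volumes; no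
continuum-physics claim.  (SCALAR calibration rung S0-A: not a gauge result.)

Venture `LatticeQCDFlow` (cell pub-lqcd), topic `Exactness`; FANOUT row 2 (`s0-phi4`, FLOW arm
`K_q = imhOp μ w q`).  NEW WORK of the cell.  A finite family of positive normalised model densities
`q̃ᵢ` (several trained flows; or ONE flow relabelled along a family of symmetries, `q̃ ∘ t_a`) and
positive weights `αᵢ`, `Σ αᵢ = 1`; the MIXTURE flow sampler proposes from `q̄ = Σ αᵢ q̃ᵢ`.  For EVERY
centred square-integrable observable `g` — no sector / parity hypothesis — whose autocorrelation
series is summable under each component sampler `K_{q̃ᵢ}`: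

  **`τ_int^{q̄}(g) + ½ ≤ 1 / Σᵢ αᵢ/(τ_int^{q̃ᵢ}(g) + ½) ≤ Σᵢ αᵢ (τ_int^{q̃ᵢ}(g) + ½)`**

(weighted harmonic, then arithmetic, mean of the components' `τ_int + ½`), the series under `K_q̄` being
summable.  Two steps, both in the tree's FORMAT-level variational calculus: (1) the mixture's Dirichlet
form dominates the weighted average of the components' (`s_q̄ ≥ Σ αᵢ s_{q̃ᵢ}` pointwise — `min` is
superadditive — Tierney 1998 Prop. 5 / Liu 2001 Thm 13.3.4 NAMED, two-component version in the tree: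
`FlowSamplerMixtureProposal`); (2) each component's sharp variational inequality
`(∫ g v w)² ≤ P Tᵢ 𝓔ᵢ(v)` (`RevOp.sq_inner_le_tsum_mul_dirichlet`, `Tᵢ = Σ_k ρᵢ(k) = τᵢ + ½`) divided by
`Tᵢ` and averaged — this is where the HARMONIC mean appears (the supremum of affine functionals of the
kernel is convex: the operator-convexity of `A ↦ A⁻¹`, NAMED, never invoked); then positivity of the
mixture sampler (`acceptanceCeiling_setup_of_sq`) + `RevOp.tauInt_le_of_forall_sq_inner_le_dirichlet_of_nonneg`.
IN THE TREE ALREADY (row 2, `Exactness/ReversibleMixture`): for a two-component mixture of arbitrary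
reversible KERNELS `M = aK₁ + (1 − a)K₂` the one-component bound `τ_M + ½ ≤ (τ₁ + ½)/a`; the present
file treats mixtures of PROPOSALS inside one Metropolis step (a different, Peskun-better kernel than
the kernel mixture), any finite number of components, and sharpens 'best component over its weight' to
the HARMONIC MEAN over every summable component.  The i.i.d. analogue (the 'balance heuristic' of
multiple importance sampling, Veach–Guibas 1995, Elvira et al. 2019) is NAMED only.  Nothing is cited
as a fact.

## What is proved

* `finMixture_facts`, `finMixture_imhFlow_ge`, **`finMixture_dirichlet_ge`** (`𝓔_q̄(v) ≥ Σ αᵢ 𝓔ᵢ(v)`);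
* `weightedHM_le_weightedAM` — `(Σ αᵢ/xᵢ)⁻¹ ≤ Σ αᵢ xᵢ`;
* **`finMixture_tauInt_le_harmonicMean`** — THE THEOREM; **`finMixture_tauInt_le_arithMean`**;
* **`finMixture_tauInt_le_harmonicMean_subset`** — the same with the sum over ANY nonempty set `S` of
  components whose series are summable (the others may be arbitrarily bad), and its one-component case
  **`finMixture_tauInt_le_single`**: `τ_int^{q̄}(g) + ½ ≤ (τ_int^{q̃ᵢ}(g) + ½)/αᵢ` — mixing other flows
  into a good one at total weight `1 − αᵢ` costs at most the factor `1/αᵢ` on `τ_int + ½`, observable by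
  observable.
The two-flow, `Z₂`-symmetrisation and symmetry-family corollaries are in
`FlowSamplerGroupSymmetrisationHarmonicMean`.

NOT CLAIMED: anything per unit cost (the mixture evaluates every component density at each proposal);
equality cases; non-summable components; any value for any network.
-/

namespace Summit.Ventures.LatticeQCDFlow.Exactness

open Real MeasureTheory Filter Finset Set Topology
open Summit.Ventures.LatticeQCDFlow.Scoring

/-- Weighted HM ≤ AM: `αᵢ ≥ 0`, `Σ αᵢ = 1`, `xᵢ > 0` ⇒ `(Σ αᵢ/xᵢ)⁻¹ ≤ Σ αᵢ xᵢ` (Jensen for `x ↦ x⁻¹`). -/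
theorem weightedHM_le_weightedAM {ι : Type*} [Fintype ι] {α x : ι → ℝ} (hα : ∀ i, 0 ≤ α i)
    (hα1 : ∑ i, α i = 1) (hx : ∀ i, 0 < x i) :
    1 / (∑ i, α i / x i) ≤ ∑ i, α i * x i := by
  have hcv : ConvexOn ℝ (Set.Ioi (0 : ℝ)) (fun x : ℝ => x⁻¹) := by
    simpa [zpow_neg_one] using (convexOn_zpow (-1) : ConvexOn ℝ (Set.Ioi (0 : ℝ)) fun x : ℝ => x ^ (-1 : ℤ))
  have h := hcv.map_sum_le (t := Finset.univ) (w := α) (p := x) (fun i _ => hα i) hα1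
    (fun i _ => Set.mem_Ioi.2 (hx i))
  simp only [smul_eq_mul] at h
  -- `h : (Σ α x)⁻¹ ≤ Σ α x⁻¹`
  have hpos : 0 < ∑ i, α i * x i := by
    -- some `α i > 0` since they sum to one
    obtain ⟨i, hi⟩ : ∃ i, 0 < α i := by
      by_contra hcon
      have h0 : ∀ i, α i ≤ 0 := fun i => le_of_not_gt fun hi => hcon ⟨i, hi⟩
      have : ∑ i, α i ≤ 0 := Finset.sum_nonpos fun i _ => h0 i
      linarith
    exact lt_of_lt_of_le (mul_pos hi (hx i))
      (Finset.single_le_sum (fun j _ => mul_nonneg (hα j) (hx j).le) (Finset.mem_univ i))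
  have hS : 0 < ∑ i, α i / x i := by
    have e : ∑ i, α i / x i = ∑ i, α i * (x i)⁻¹ := Finset.sum_congr rfl fun i _ => div_eq_mul_inv _ _
    rw [e]
    exact lt_of_lt_of_le (inv_pos.2 hpos) h
  have e : ∑ i, α i / x i = ∑ i, α i * (x i)⁻¹ := Finset.sum_congr rfl fun i _ => div_eq_mul_inv _ _
  rw [e] at hS ⊢
  rw [div_le_iff₀ hS]
  calc (1 : ℝ) = (∑ i, α i * x i) * (∑ i, α i * x i)⁻¹ := by rw [mul_inv_cancel₀ hpos.ne']
    _ ≤ (∑ i, α i * x i) * ∑ i, α i * (x i)⁻¹ := mul_le_mul_of_nonneg_left h hpos.le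

section General

variable {X : Type*} [MeasurableSpace X] {μ : Measure X} [SFinite μ] {w : X → ℝ}
  {ι : Type*} [Fintype ι] {q : ι → X → ℝ} {α : ι → ℝ}

/-! ## §1 The mixture density and its flow kernel -/

omit [SFinite μ] in
/-- `q̄ = Σ αᵢ q̃ᵢ` is a positive, measurable, normalised model density (`αᵢ > 0`, `Σ αᵢ = 1`). -/
theorem finMixture_facts [Nonempty ι] (hα : ∀ i, 0 < α i) (hα1 : ∑ i, α i = 1)
    (hq0 : ∀ i x, 0 < q i x) (hqm : ∀ i, Measurable (q i)) (hqi : ∀ i, Integrable (q i) μ)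
    (hq1 : ∀ i, ∫ z, q i z ∂μ = 1) :
    (∀ x, 0 < ∑ i, α i * q i x) ∧ Measurable (fun x => ∑ i, α i * q i x) ∧
    Integrable (fun x => ∑ i, α i * q i x) μ ∧ (∫ x, ∑ i, α i * q i x ∂μ = 1) := by
  refine ⟨fun x => Finset.sum_pos (fun i _ => mul_pos (hα i) (hq0 i x)) Finset.univ_nonempty,
    Finset.measurable_sum _ fun i _ => (hqm i).const_mul _,
    integrable_finsetSum Finset.univ fun i _ => (hqi i).const_mul _, ?_⟩
  rw [integral_finsetSum Finset.univ fun i _ => (hqi i).const_mul _]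
  simp only [integral_const_mul, hq1, mul_one, hα1]

omit [MeasurableSpace X] [Fintype ι] in
/-- **The mixture's flow kernel dominates the mixture of the flow kernels**:
`Σ αᵢ s_{q̃ᵢ}(x,y) ≤ s_q̄(x,y)` (`min` superadditive; `αᵢ ≥ 0`). -/
theorem finMixture_imhFlow_ge (s : Finset ι) (hα : ∀ i, 0 ≤ α i) (x y : X) :
    ∑ i ∈ s, α i * imhFlow w (q i) x y ≤ imhFlow w (fun z => ∑ i ∈ s, α i * q i z) x y := by
  unfold imhFlow
  have e : ∀ i, α i * min (w x * q i y) (w y * q i x)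
      = min (α i * (w x * q i y)) (α i * (w y * q i x)) := fun i => (mul_min_of_nonneg _ _ (hα i))
  simp only [e]
  refine (Literature.Probability.MarkovChains.sum_min_le_min_sum s _ _).trans (le_of_eq ?_)
  rw [Finset.mul_sum, Finset.mul_sum]
  congr 1 <;> exact Finset.sum_congr rfl fun i _ => by ring

/-- **`𝓔_q̄(v) ≥ Σ αᵢ 𝓔_{q̃ᵢ}(v)`** for every square-integrable `v` (Dirichlet representation, termwise). -/
theorem finMixture_dirichlet_ge [Nonempty ι] (hα : ∀ i, 0 < α i) (hα1 : ∑ i, α i = 1)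
    (hw0 : ∀ x, 0 < w x) (hwm : Measurable w) (hwi : Integrable w μ)
    (hq0 : ∀ i x, 0 < q i x) (hqm : ∀ i, Measurable (q i)) (hqi : ∀ i, Integrable (q i) μ)
    (hq1 : ∀ i, ∫ z, q i z ∂μ = 1) {v : X → ℝ} (hvm : Measurable v)
    (hv2 : Integrable (fun x => v x ^ 2 * w x) μ) :
    ∑ i, α i * ((∫ x, v x ^ 2 * w x ∂μ) - ∫ x, v x * imhOp μ w (q i) v x * w x ∂μ)
      ≤ (∫ x, v x ^ 2 * w x ∂μ) - ∫ x, v x * imhOp μ w (fun z => ∑ i, α i * q i z) v x * w x ∂μ := by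
  obtain ⟨hs0, hsm, hsi, hs1⟩ := finMixture_facts hα hα1 hq0 hqm hqi hq1
  have hEi : ∀ i, (∫ x, v x ^ 2 * w x ∂μ) - ∫ x, v x * imhOp μ w (q i) v x * w x ∂μ
      = (1 / 2) * ∫ p, imhFlow w (q i) p.1 p.2 * (v p.1 - v p.2) ^ 2 ∂(μ.prod μ) := fun i =>
    dirichlet_eq_half_sq_of_sq hw0 hwm hwi (hq0 i) (hqm i) (hqi i) (hq1 i) hvm hv2
  simp only [hEi]
  rw [dirichlet_eq_half_sq_of_sq hw0 hwm hwi hs0 hsm hsi hs1 hvm hv2]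
  have hIi : ∀ i, Integrable (fun p : X × X => imhFlow w (q i) p.1 p.2 * (v p.1 - v p.2) ^ 2) (μ.prod μ) :=
    fun i => integrable_imhFlow_mul_sq_sub hw0 hwm (hq0 i) (hqm i) (hqi i) hvm hv2
  have hIs := integrable_imhFlow_mul_sq_sub hw0 hwm hs0 hsm hsi hvm hv2
  have e : ∑ i, α i * ((1 / 2) * ∫ p, imhFlow w (q i) p.1 p.2 * (v p.1 - v p.2) ^ 2 ∂(μ.prod μ))
      = (1 / 2) * ∫ p, ∑ i, α i * (imhFlow w (q i) p.1 p.2 * (v p.1 - v p.2) ^ 2) ∂(μ.prod μ) := by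
    rw [integral_finsetSum Finset.univ fun i _ => (hIi i).const_mul _, Finset.mul_sum]
    refine Finset.sum_congr rfl fun i _ => ?_
    rw [integral_const_mul]
    ring
  rw [e]
  refine mul_le_mul_of_nonneg_left ?_ (by norm_num)
  refine integral_mono (integrable_finsetSum Finset.univ fun i _ => (hIi i).const_mul _) hIs
    fun p => ?_
  have h := finMixture_imhFlow_ge (w := w) (q := q) Finset.univ (fun i => (hα i).le) p.1 p.2
  calc ∑ i, α i * (imhFlow w (q i) p.1 p.2 * (v p.1 - v p.2) ^ 2)
      = (∑ i, α i * imhFlow w (q i) p.1 p.2) * (v p.1 - v p.2) ^ 2 := by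
        rw [Finset.sum_mul]
        exact Finset.sum_congr rfl fun i _ => by ring
    _ ≤ imhFlow w (fun z => ∑ i, α i * q i z) p.1 p.2 * (v p.1 - v p.2) ^ 2 :=
        mul_le_mul_of_nonneg_right h (sq_nonneg _)

/-! ## §2 The harmonic-mean bound -/

/-- **A MIXTURE OF FLOWS IS NEVER WORSE THAN THE HARMONIC MEAN OF ANY SET OF ITS SUMMABLE
COMPONENTS.**  `w > 0` measurable integrable; `q̃ᵢ > 0` measurable, `∫ q̃ᵢ = 1`; `αᵢ > 0`, `Σ αᵢ = 1`;
`g` measurable, `∫ g² w < ∞`, `∫ g² w > 0`; `S` a nonempty set of indices such that for each `i ∈ S` the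
normalised autocorrelation series of `g` under `imhOp μ w q̃ᵢ` is summable (`τᵢ` its `τ_int`; nothing
is asked of the components outside `S`).  Then under the mixture sampler `imhOp μ w (Σ αᵢ q̃ᵢ)` the
series is summable and `τ_int + ½ ≤ 1/Σ_{i ∈ S} αᵢ/(τᵢ + ½)`. -/
theorem finMixture_tauInt_le_harmonicMean_subset [Nonempty ι] (hα : ∀ i, 0 < α i)
    (hα1 : ∑ i, α i = 1) (hw0 : ∀ x, 0 < w x) (hwm : Measurable w) (hwi : Integrable w μ)
    (hq0 : ∀ i x, 0 < q i x) (hqm : ∀ i, Measurable (q i)) (hqi : ∀ i, Integrable (q i) μ)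
    (hq1 : ∀ i, ∫ z, q i z ∂μ = 1) {g : X → ℝ} (hgm : Measurable g)
    (hg2 : Integrable (fun x => g x ^ 2 * w x) μ) (hP : 0 < ∫ x, g x ^ 2 * w x ∂μ)
    {S : Finset ι} (hS : S.Nonempty)
    (hs : ∀ i ∈ S, Summable fun n => (∫ x, g x * ((imhOp μ w (q i))^[n + 1] g) x * w x ∂μ)
      / ∫ x, g x ^ 2 * w x ∂μ) :
    (Summable fun n => (∫ x, g x * ((imhOp μ w (fun z => ∑ i, α i * q i z))^[n + 1] g) x * w x ∂μ)
        / ∫ x, g x ^ 2 * w x ∂μ) ∧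
    tauInt (fun n => (∫ x, g x * ((imhOp μ w (fun z => ∑ i, α i * q i z))^[n] g) x * w x ∂μ)
        / ∫ x, g x ^ 2 * w x ∂μ) + 1 / 2
      ≤ 1 / ∑ i ∈ S, α i / (tauInt (fun n => (∫ x, g x * ((imhOp μ w (q i))^[n] g) x * w x ∂μ)
          / ∫ x, g x ^ 2 * w x ∂μ) + 1 / 2) := by
  obtain ⟨hs0, hsm, hsi, hs1⟩ := finMixture_facts hα hα1 hq0 hqm hqi hq1
  set P := ∫ x, g x ^ 2 * w x ∂μ with hPdef
  set C : ι → ℕ → ℝ := fun i k => ∫ x, g x * ((imhOp μ w (q i))^[k] g) x * w x ∂μ with hC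
  set T : ι → ℝ := fun i => ∑' k, C i k / P with hT
  -- positivity of every sampler involved
  have hposi : ∀ i k, 0 ≤ C i k := fun i =>
    (acceptanceCeiling_setup_of_sq hw0 hwm hwi (hq0 i) (hqm i) (hqi i) (hq1 i) hgm hg2).2
  have hposs := (acceptanceCeiling_setup_of_sq hw0 hwm hwi hs0 hsm hsi hs1 hgm hg2).2
  have hC0 : ∀ i, C i 0 / P = 1 := fun i => by
    have e : C i 0 = P := by
      simp only [hC, hPdef, Function.iterate_zero, id_eq]
      exact integral_congr_ae (Eventually.of_forall fun x => by ring)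
    rw [e, div_self hP.ne']
  have hsum0 : ∀ i ∈ S, Summable fun k => C i k / P := fun i hi => (summable_nat_add_iff 1).1 (hs i hi)
  -- `Tᵢ = τᵢ + ½ ≥ 1 > 0` on `S`
  have hTi : ∀ i, T i = ∑' k, C i k / P := fun i => rfl
  have hTeq : ∀ i ∈ S, T i = tauInt (fun n => C i n / P) + 1 / 2 := fun i hi => by
    rw [hTi, (hsum0 i hi).tsum_eq_zero_add, hC0]
    unfold tauInt
    ring
  have hTpos : ∀ i ∈ S, 0 < T i := fun i hi => by
    rw [hTi, (hsum0 i hi).tsum_eq_zero_add, hC0]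
    have h : 0 ≤ ∑' k, C i (k + 1) / P := tsum_nonneg fun k => div_nonneg (hposi i _) hP.le
    linarith
  -- the harmonic-mean constant
  set H := ∑ i ∈ S, α i / T i with hH
  have hHpos : 0 < H := Finset.sum_pos (fun i hi => div_pos (hα i) (hTpos i hi)) hS
  have hB : 0 ≤ P * (1 / H) := mul_nonneg hP.le (div_pos one_pos hHpos).le
  -- Dirichlet forms are nonnegative
  have hE0 : ∀ i {v : X → ℝ}, Measurable v → Integrable (fun t => v t ^ 2 * w t) μ →
      0 ≤ (∫ x, v x ^ 2 * w x ∂μ) - ∫ x, v x * imhOp μ w (q i) v x * w x ∂μ := fun i v hvm hv2 => by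
    rw [dirichlet_eq_half_sq_of_sq hw0 hwm hwi (hq0 i) (hqm i) (hqi i) (hq1 i) hvm hv2]
    exact mul_nonneg (by norm_num) (integral_nonneg fun p =>
      mul_nonneg (imhFlow_nonneg_le hw0 (hq0 i) p.1 p.2).1 (sq_nonneg _))
  -- the variational bound for the MIXTURE sampler with constant `P/H`
  have hvar : ∀ ⦃v : X → ℝ⦄, (Measurable v ∧ Integrable (fun t => v t ^ 2 * w t) μ) →
      (∫ x, g x * v x * w x ∂μ) ^ 2
        ≤ P * (1 / H) * ((∫ x, v x ^ 2 * w x ∂μ)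
          - ∫ x, v x * imhOp μ w (fun z => ∑ i, α i * q i z) v x * w x ∂μ) := by
    intro v hv
    set Bv := ∫ x, g x * v x * w x ∂μ with hBv
    set E : ι → ℝ := fun i => (∫ x, v x ^ 2 * w x ∂μ) - ∫ x, v x * imhOp μ w (q i) v x * w x ∂μ with hE
    -- per summable component: `Bv² ≤ P Tᵢ Eᵢ`, i.e. `Bv² αᵢ/Tᵢ ≤ P αᵢ Eᵢ`
    have hi : ∀ i ∈ S, Bv ^ 2 * (α i / T i) ≤ P * (α i * E i) := fun i hiS => by
      have h2 := RevOp.sq_inner_le_tsum_mul_dirichlet (A := fun f : X → ℝ =>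
          Measurable f ∧ Integrable (fun t => f t ^ 2 * w t) μ) (K := imhOp μ w (q i))
        (fun x => (hw0 x).le) (sqClass_int hw0 hwm) (sqClass_comb hw0 hwm)
        (sqClass_stab hw0 hwm hwi (hq0 i) (hqm i) (hqi i) (hq1 i))
        (sqClass_lin hw0 hwm hwi (hq0 i) (hqm i) (hqi i))
        (sqClass_symm hw0 hwm hwi (hq0 i) (hqm i) (hqi i) (hq1 i))
        (sqClass_contr hw0 hwm hwi (hq0 i) (hqm i) (hqi i) (hq1 i)) ⟨hgm, hg2⟩ hv (hs i hiS)
      have h3 : Bv ^ 2 / T i ≤ P * E i := by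
        rw [div_le_iff₀ (hTpos i hiS)]
        calc Bv ^ 2 ≤ P * (T i * E i) := h2
          _ = P * E i * T i := by ring
      calc Bv ^ 2 * (α i / T i) = α i * (Bv ^ 2 / T i) := by ring
        _ ≤ α i * (P * E i) := mul_le_mul_of_nonneg_left h3 (hα i).le
        _ = P * (α i * E i) := by ring
    have hsumS : Bv ^ 2 * H ≤ P * ∑ i ∈ S, α i * E i := by
      rw [hH, Finset.mul_sum, Finset.mul_sum]
      exact Finset.sum_le_sum fun i hiS => hi i hiS
    have hSU : ∑ i ∈ S, α i * E i ≤ ∑ i, α i * E i :=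
      Finset.sum_le_univ_sum_of_nonneg fun i => mul_nonneg (hα i).le (hE0 i hv.1 hv.2)
    have hdom := finMixture_dirichlet_ge hα hα1 hw0 hwm hwi hq0 hqm hqi hq1 hv.1 hv.2
    calc Bv ^ 2 = Bv ^ 2 * H * (1 / H) := by field_simp
      _ ≤ P * (∑ i ∈ S, α i * E i) * (1 / H) :=
          mul_le_mul_of_nonneg_right hsumS (div_pos one_pos hHpos).le
      _ ≤ P * (∑ i, α i * E i) * (1 / H) :=
          mul_le_mul_of_nonneg_right (mul_le_mul_of_nonneg_left hSU hP.le) (div_pos one_pos hHpos).le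
      _ ≤ P * ((∫ x, v x ^ 2 * w x ∂μ)
            - ∫ x, v x * imhOp μ w (fun z => ∑ i, α i * q i z) v x * w x ∂μ) * (1 / H) :=
          mul_le_mul_of_nonneg_right (mul_le_mul_of_nonneg_left hdom hP.le)
            (div_pos one_pos hHpos).le
      _ = P * (1 / H) * ((∫ x, v x ^ 2 * w x ∂μ)
            - ∫ x, v x * imhOp μ w (fun z => ∑ i, α i * q i z) v x * w x ∂μ) := by ring
  obtain ⟨hsumM, hτ⟩ := RevOp.tauInt_le_of_forall_sq_inner_le_dirichlet_of_nonneg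
    (A := fun f : X → ℝ => Measurable f ∧ Integrable (fun t => f t ^ 2 * w t) μ)
    (K := imhOp μ w (fun z => ∑ i, α i * q i z)) (sqClass_int hw0 hwm) (sqClass_comb hw0 hwm)
    (sqClass_stab hw0 hwm hwi hs0 hsm hsi hs1) (sqClass_lin hw0 hwm hwi hs0 hsm hsi)
    (sqClass_symm hw0 hwm hwi hs0 hsm hsi hs1) ⟨hgm, hg2⟩ hP hposs hB hvar
  refine ⟨hsumM, ?_⟩
  have e : P * (1 / H) / P - 1 / 2 = 1 / H - 1 / 2 := by field_simp
  rw [e] at hτ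
  have eH : H = ∑ i ∈ S, α i / (tauInt (fun n => C i n / P) + 1 / 2) := by
    rw [hH]
    exact Finset.sum_congr rfl fun i hi => by rw [hTeq i hi]
  rw [← eH]
  linarith

/-- **ALL COMPONENTS SUMMABLE: `τ_int^{q̄}(g) + ½ ≤ 1/Σᵢ αᵢ/(τ_int^{q̃ᵢ}(g) + ½)`** (the weighted harmonic
mean of the components' `τ_int + ½`). -/
theorem finMixture_tauInt_le_harmonicMean [Nonempty ι] (hα : ∀ i, 0 < α i) (hα1 : ∑ i, α i = 1)
    (hw0 : ∀ x, 0 < w x) (hwm : Measurable w) (hwi : Integrable w μ)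
    (hq0 : ∀ i x, 0 < q i x) (hqm : ∀ i, Measurable (q i)) (hqi : ∀ i, Integrable (q i) μ)
    (hq1 : ∀ i, ∫ z, q i z ∂μ = 1) {g : X → ℝ} (hgm : Measurable g)
    (hg2 : Integrable (fun x => g x ^ 2 * w x) μ) (hP : 0 < ∫ x, g x ^ 2 * w x ∂μ)
    (hs : ∀ i, Summable fun n => (∫ x, g x * ((imhOp μ w (q i))^[n + 1] g) x * w x ∂μ)
      / ∫ x, g x ^ 2 * w x ∂μ) :
    (Summable fun n => (∫ x, g x * ((imhOp μ w (fun z => ∑ i, α i * q i z))^[n + 1] g) x * w x ∂μ)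
        / ∫ x, g x ^ 2 * w x ∂μ) ∧
    tauInt (fun n => (∫ x, g x * ((imhOp μ w (fun z => ∑ i, α i * q i z))^[n] g) x * w x ∂μ)
        / ∫ x, g x ^ 2 * w x ∂μ) + 1 / 2
      ≤ 1 / ∑ i, α i / (tauInt (fun n => (∫ x, g x * ((imhOp μ w (q i))^[n] g) x * w x ∂μ)
          / ∫ x, g x ^ 2 * w x ∂μ) + 1 / 2) :=
  finMixture_tauInt_le_harmonicMean_subset hα hα1 hw0 hwm hwi hq0 hqm hqi hq1 hgm hg2 hP
    Finset.univ_nonempty fun i _ => hs i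

/-- **ONE GOOD COMPONENT SUFFICES: `τ_int^{q̄}(g) + ½ ≤ (τ_int^{q̃ᵢ}(g) + ½)/αᵢ`** — mixing arbitrary
other flows into `q̃ᵢ` at total weight `1 − αᵢ` costs at most the factor `1/αᵢ` on `τ_int + ½`,
observable by observable (summability under `q̃ᵢ` alone). -/
theorem finMixture_tauInt_le_single [Nonempty ι] (hα : ∀ i, 0 < α i) (hα1 : ∑ i, α i = 1)
    (hw0 : ∀ x, 0 < w x) (hwm : Measurable w) (hwi : Integrable w μ)
    (hq0 : ∀ i x, 0 < q i x) (hqm : ∀ i, Measurable (q i)) (hqi : ∀ i, Integrable (q i) μ)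
    (hq1 : ∀ i, ∫ z, q i z ∂μ = 1) {g : X → ℝ} (hgm : Measurable g)
    (hg2 : Integrable (fun x => g x ^ 2 * w x) μ) (hP : 0 < ∫ x, g x ^ 2 * w x ∂μ) (i : ι)
    (hs : Summable fun n => (∫ x, g x * ((imhOp μ w (q i))^[n + 1] g) x * w x ∂μ)
      / ∫ x, g x ^ 2 * w x ∂μ) :
    (Summable fun n => (∫ x, g x * ((imhOp μ w (fun z => ∑ j, α j * q j z))^[n + 1] g) x * w x ∂μ)
        / ∫ x, g x ^ 2 * w x ∂μ) ∧
    tauInt (fun n => (∫ x, g x * ((imhOp μ w (fun z => ∑ j, α j * q j z))^[n] g) x * w x ∂μ)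
        / ∫ x, g x ^ 2 * w x ∂μ) + 1 / 2
      ≤ (tauInt (fun n => (∫ x, g x * ((imhOp μ w (q i))^[n] g) x * w x ∂μ)
          / ∫ x, g x ^ 2 * w x ∂μ) + 1 / 2) / α i := by
  obtain ⟨hsum, h⟩ := finMixture_tauInt_le_harmonicMean_subset hα hα1 hw0 hwm hwi hq0 hqm hqi hq1 hgm
    hg2 hP (Finset.singleton_nonempty i) (fun j hj => by rw [Finset.mem_singleton.1 hj]; exact hs)
  refine ⟨hsum, h.trans (le_of_eq ?_)⟩
  rw [Finset.sum_singleton, one_div_div]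

/-- **… HENCE NEVER WORSE THAN THEIR ARITHMETIC MEAN**: `τ_int^{q̄}(g) ≤ Σ αᵢ τ_int^{q̃ᵢ}(g)`. -/
theorem finMixture_tauInt_le_arithMean [Nonempty ι] (hα : ∀ i, 0 < α i) (hα1 : ∑ i, α i = 1)
    (hw0 : ∀ x, 0 < w x) (hwm : Measurable w) (hwi : Integrable w μ)
    (hq0 : ∀ i x, 0 < q i x) (hqm : ∀ i, Measurable (q i)) (hqi : ∀ i, Integrable (q i) μ)
    (hq1 : ∀ i, ∫ z, q i z ∂μ = 1) {g : X → ℝ} (hgm : Measurable g)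
    (hg2 : Integrable (fun x => g x ^ 2 * w x) μ) (hP : 0 < ∫ x, g x ^ 2 * w x ∂μ)
    (hs : ∀ i, Summable fun n => (∫ x, g x * ((imhOp μ w (q i))^[n + 1] g) x * w x ∂μ)
      / ∫ x, g x ^ 2 * w x ∂μ) :
    tauInt (fun n => (∫ x, g x * ((imhOp μ w (fun z => ∑ i, α i * q i z))^[n] g) x * w x ∂μ)
        / ∫ x, g x ^ 2 * w x ∂μ)
      ≤ ∑ i, α i * tauInt (fun n => (∫ x, g x * ((imhOp μ w (q i))^[n] g) x * w x ∂μ)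
          / ∫ x, g x ^ 2 * w x ∂μ) := by
  obtain ⟨-, hHM⟩ := finMixture_tauInt_le_harmonicMean hα hα1 hw0 hwm hwi hq0 hqm hqi hq1 hgm hg2 hP hs
  set P := ∫ x, g x ^ 2 * w x ∂μ with hPdef
  set τ : ι → ℝ := fun i => tauInt (fun n => (∫ x, g x * ((imhOp μ w (q i))^[n] g) x * w x ∂μ) / P)
    with hτ
  -- `τᵢ + ½ > 0` (the series has nonnegative terms)
  have hpos : ∀ i, 0 < τ i + 1 / 2 := fun i => by
    have hposi := (acceptanceCeiling_setup_of_sq hw0 hwm hwi (hq0 i) (hqm i) (hqi i) (hq1 i) hgm hg2).2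
    have h : 0 ≤ ∑' k, (∫ x, g x * ((imhOp μ w (q i))^[k + 1] g) x * w x ∂μ) / P :=
      tsum_nonneg fun k => div_nonneg (hposi _) hP.le
    show 0 < tauInt _ + 1 / 2
    unfold tauInt
    linarith
  have hAM := weightedHM_le_weightedAM (fun i => (hα i).le) hα1 hpos
  have e : ∑ i, α i * (τ i + 1 / 2) = (∑ i, α i * τ i) + 1 / 2 := by
    rw [← sub_eq_zero]
    have : ∑ i, α i * (τ i + 1 / 2) = ∑ i, α i * τ i + (∑ i, α i) * (1 / 2) := by
      rw [Finset.sum_mul, ← Finset.sum_add_distrib]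
      exact Finset.sum_congr rfl fun i _ => by ring
    rw [this, hα1]
    ring
  rw [e] at hAM
  linarith

end General

end Summit.Ventures.LatticeQCDFlow.Exactness
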